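import Summits.BirchSwinnertonDyer.BirchSwinnertonDyer.Theorems.SignedLowerHalvesSmallImageLowerHalfBothSignsRttD2J2DeltaLevelMap
import Literature.NumberTheory.ComplexMultiplication.EllipticUnits.ImaginaryQuadraticMainConjectureCarriersOCoresTransitive
import HarnessLib

/-!
# Route `SignedLowerHalves`, crux L `SmallImageLowerHalfBothSigns` (stmt-BirchSwinnertonDyer-23599), line `rtt_w3` v29 — row **S3α** (`stub_junctionSha_ns`), brick **α1**
# (the specialisation `sp²` in DEGREE 2), INJECTIVITY HALF, brick (i-a): THE FINITE-LEVEL KERNEL TRANSFER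
# `cor_{K̃_m/K^{(1)}_m} z = 0 ⇒ cor_{K̃_m/K̃_n} z ∈ range (conj_{γ₂} − 1)` (`n + k ≤ m`) — NO `cd_p ≤ 2`, NO `H³ = 0`

INPUTS hand `bsd-inputs-honda-p1` g27 under LEAD `cruxlead-stmt-BirchSwinnertonDyer-23599` g13 (DESIGN `Lines/rtt_w3-DESIGN-S3alpha-lead-g13.md`, brick α1 «∃ e :
QuotSMulTop (C (X − C 0)) D₂'.H →ₗ[Λ_𝒪] I₂.H, Injective e»; the map `e` is `…RttJunctionShaSp2Map.exists_specialisationLinearMap₂_frame_zero`). Helper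
`--supports stmt-BirchSwinnertonDyer-23599`. THEOREMS ONLY; no named fact, no `sorry`; the instance recipes of honda g24's brick (δ-d2) are LOCAL instances here.

THE POINT (why no cohomological-dimension input is needed for INJECTIVITY): in honda g24's permutation model (bricks (δ-a)–(δ-c) of the J2 research half) the
short exact sequence `0 → ker Σ′ → Maps(G ⧸ V′, M) —Σ′→ Maps(G ⧸ U′, M) → 0` (`isSES_kerIncl_coindFinSum`) gives, by EXACTNESS AT `H²(Maps(G ⧸ V′, M))` (tree
`IsSES.exists_map_two_eq_of_map_two_eq_zero`, Serre I §2.2), that a class `x` of `H²(G, Maps(G ⧸ V′, M)) = H²(V′, M)` killed by `H²(Σ′) = cor_{V′→U′}` is `H²(ι) u` with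
`u ∈ H²(G, ker Σ′)`; and g24's WRONG-WAY map `r : ker Σ′ → Maps(G ⧸ V, M)` (`rHom`, `(R_c − 1) ∘ r = Σ_{V′→V} ∘ ι`: `rTransHom_rHom_sub`, available once `[V ⊓ U′ : V′]` kills `M`)
turns this into `H²(Σ_{V′→V}) x = (H²(R_c) − 1)(H²(r) u)` — the obstruction class in `H³(U′, M)` to solving `x = (R_c − 1) v` AT LEVEL `V′` is bypassed by pushing down to
`V`, exactly as g24 bypassed `H²(U′, M)` in degree `1`.
* §1 ★ `exists_rTransHom_sub_eq_of_map_two_eq_zero` — the generic statement (any compact `G`, discrete finite `M`).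
* §2 ★★ `exists_layerConjO_sub_eq_of_spLevel_eq_zero` — honda's currency through the Shapiro dictionary `shO_coindFinSum`/`shO_rTransHom_two` (brick (δ-d2)):
  `spLevel m k 2 z = 0 ⇒ ∃ y : H²(G_S(K̃_n), X_k), conj_{γ₂} y − y = cor_{K̃_m/K̃_n} z` for `n + k ≤ m`, under g24's tower hypotheses `γ₂ ∈ ker κ₁`, `κ₂ γ₂ ∈ ℤ_pˣ`,
  `N_{p𝔣} ≤ Gal(K̄/K̃_m)`.
* §3 `relCoresO_pair_proj` (`proj_{n,k} = cor_{K̃_m/K̃_n} ∘ proj_{m,k}` on ANY pinned two-variable datum, every degree — (P1) iterated through the all-degree transitivity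
  `relCoresO_relCoresO`, honda g27 p812404) and ★★ `exists_layerConjO_sub_eq_proj_of_res_eq_zero`: for pinned `D₂` (degree 2), `I₂` and `sp²` (`hres`), `sp² x = 0 ⇒` at EVERY
  level `(n, k)` the projection `D₂.proj n k x` is `conj_{γ₂} y − y` for some `y` — the levelwise form of `ker sp² ⊆ T₂ • 𝐇²₂`; brick (i-b) (`…Sp2Injective`) glues the `y`'s by
  Kőnig and concludes `Function.Injective e`.
HONEST FRAMING: S3α, S3β, S4′, E2, crux L, crux M and BSD remain OPEN; BSD is proved for NO curve.

References: [SerreGaloisCohomology1997] I §2.2–§2.5; [PerrinRiou1994Invent] §1.3 (descent of Iwasawa cohomology); [NeukirchSchmidtWingberg2008] (1.3.2), I §5 (1.5.3)–(1.5.7),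
I §6 (1.6.4)–(1.6.5); [JohnsonLeungKings2011] §4.2 Def. 4.2 (94), Lemma 4.4; [SerreLocalFields1979] VII §5.
-/

set_option autoImplicit false
-- the Theorems namespace of this sub repeats the summit name by design (D-0017 nested layout)
set_option linter.dupNamespace false

noncomputable section

open scoped NumberField
open CategoryTheory Field IsDedekindDomain
open Literature.NumberTheory.GaloisRepresentations
open Literature.NumberTheory.EllipticCurves
open Literature.NumberTheory.ComplexMultiplication.EllipticUnits.JohnsonLeungKings2011
open Summit.BirchSwinnertonDyer.BirchSwinnertonDyer.Theorems.SmallImageRttD2J1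
open Summit.BirchSwinnertonDyer.BirchSwinnertonDyer.Theorems.SmallImageRttD2J2
open Summit.BirchSwinnertonDyer.BirchSwinnertonDyer.Theorems.SmallImageRttD2J2Delta

namespace Summit.BirchSwinnertonDyer.BirchSwinnertonDyer.Theorems.SmallImageRttJunctionSha

universe u

/-! ## §1 The generic finite-level kernel transfer in the permutation model (degree 2) -/

section Perm

variable {G : Type u} [Group G] [TopologicalSpace G] [IsTopologicalGroup G] [CompactSpace G] [LocallyCompactSpace G]
variable {M : Type u} [AddCommGroup M] [TopologicalSpace M] [DiscreteTopology M] (ρ : ContinuousRep G ℤ M)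
variable {U' V' V : Subgroup G} (h' : V' ≤ U') (hVV : V' ≤ V) [V'.Normal] [V.Normal] (c : G) [Fintype (G ⧸ V')]
  [Fintype (G ⧸ U')] [Finite M] [Fintype (G ⧸ (V ⊓ U'))]

/-- ★ **KERNEL TRANSFER, generic**: if `x ∈ H²(G, Maps(G ⧸ V′, M))` is killed by the fibre sum `H²(Σ_{V′→U′})` (= `cor_{V′→U′}` under Shapiro), then its push-down
`H²(Σ_{V′→V}) x` lies in the range of `H²(R_c) − 1` on `H²(G, Maps(G ⧸ V, M))` — exactness at `H²(Maps(G ⧸ V′, M))` of `0 → ker Σ′ → Maps(G ⧸ V′) → Maps(G ⧸ U′) → 0`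
and the wrong-way identity `(R_c − 1) ∘ r = Σ_{V′→V} ∘ ι`. No vanishing of any `H³` is used. [cite: SerreGaloisCohomology1997, I §2.2–§2.3] [cite: PerrinRiou1994Invent, §1.3] -/
theorem exists_rTransHom_sub_eq_of_map_two_eq_zero (hU' : IsOpen (U' : Set G)) (hV' : IsOpen (V' : Set G)) (hc : c ∈ U')
    (hgen : ∀ y y' : G ⧸ V', Subgroup.quotientMapOfLE h' y = Subgroup.quotientMapOfLE h' y' → ∃ j : ℕ, y' = y * (c : G ⧸ V') ^ j)
    (hidx : ∀ x : M, (V'.subgroupOf (V ⊓ U')).index • x = 0) (x : continuousCohomology 2 (coindFin.{0, u} ρ.toTopRep V'))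
    (hx : cohomologyMap (coindFinSum ρ.toTopRep h') 2 x = 0) :
    ∃ v : continuousCohomology 2 (coindFin.{0, u} ρ.toTopRep V),
      cohomologyMap (rTransHom ρ.toTopRep V (c : G ⧸ V)) 2 v - v = cohomologyMap (coindFinSum ρ.toTopRep hVV) 2 x := by
  obtain ⟨u, rfl⟩ := (isSES_kerIncl_coindFinSum ρ h' hV' hU').exists_map_two_eq_of_map_two_eq_zero x hx
  refine ⟨cohomologyMap (rHom ρ h' hVV c hV' hc hgen hidx) 2 u, ?_⟩
  have hsum := cohomologyMap_comp_apply_of_sum (rHom ρ h' hVV c hV' hc hgen hidx) (rTransHom ρ.toTopRep V (c : G ⧸ V)) (Finset.univ : Finset Bool)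
    (fun b => if b then rHom ρ h' hVV c hV' hc hgen hidx else kerIncl ρ h' hV' ≫ coindFinSum ρ.toTopRep hVV) (fun ψ => by
      rw [Fintype.sum_bool, if_pos rfl, if_neg Bool.false_ne_true]
      have h1 := rTransHom_rHom_sub ρ h' hVV c hV' hc hgen hidx ψ
      rw [sub_eq_iff_eq_add] at h1
      rw [h1, add_comm]
      rfl) 2 u
  rw [hsum, Fintype.sum_bool, if_pos rfl, if_neg Bool.false_ne_true, add_sub_cancel_left]
  exact (cohomologyMap_comp_apply_of_eq (kerIncl ρ h' hV') (coindFinSum ρ.toTopRep hVV) _ (fun _ => rfl) 2 u).symm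

end Perm

/-! ## §2 Honda's currency: `spLevel m k 2 z = 0 ⇒ cor_{K̃_m/K̃_n} z = conj_{γ₂} y − y` -/

section Level

variable {K : Type} [Field K] [NumberField K] {p : ℕ} [Fact p.Prime] (S : Set (PadicAlgCl p)) [FiniteDimensional ℚ_[p] (padicCoeffField S)]
  (κ₁ κ₂ : ZpExtension K p) {γ₂ : absoluteGaloisGroup K} (θ : absoluteGaloisGroup K →ₜ* (padicCoeffIntegers S)ˣ) (𝔣 : Ideal (𝓞 K))
  (hγ₁ : γ₂ ∈ κ₁.kerSubgroup) (hγu : IsUnit (κ₂ γ₂).toAdd) (hV : ∀ m : ℕ, ramificationSubgroup K (suppPF p 𝔣) ≤ pairLayerSubgroup κ₁ κ₂ m)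

attribute [local instance] totallyDisconnectedSpace_GS normal_imGS fintypeQuotLayer fintypeQuotPairLayer fintypeQuotPairInfLayer finite_invariantsOf_muTwistO

include hγ₁ hγu hV in
/-- ★★ **KERNEL TRANSFER in honda's currency**: for `n + k ≤ m` and `z ∈ H²(G_S(K̃_m), X_k)` with `cor_{K̃_m/K^{(1)}_m} z = 0` (`spLevel m k 2 z = 0`), the push-down
`cor_{K̃_m/K̃_n} z` is `conj_{γ₂} y − y` for some `y ∈ H²(G_S(K̃_n), X_k)` (§1 through `shO_coindFinSum` twice and `shO_rTransHom_two`; the wrong-way hypotheses are g24's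
brick (δ-d1): `exists_eq_mul_pow_of_proj_eq`, `index_smul_eq_zero`). [cite: PerrinRiou1994Invent, §1.3] [cite: SerreGaloisCohomology1997, I §2.2–§2.5]
[cite: NeukirchSchmidtWingberg2008, I §5 (1.5.3)–(1.5.7), I §6 (1.6.4)–(1.6.5)] -/
theorem exists_layerConjO_sub_eq_of_spLevel_eq_zero (k : ℕ) {n m : ℕ} (hnkm : n + k ≤ m) (z : layerCohO S κ₁ κ₂ θ 𝔣 m k 2)
    (hz : spLevel S κ₁ κ₂ θ 𝔣 m k 2 z = 0) :
    ∃ y : layerCohO S κ₁ κ₂ θ 𝔣 n k 2, layerConjO S κ₁ κ₂ θ 𝔣 n k 2 γ₂ y - y =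
      relCoresO S (suppPF p 𝔣) θ (pairLayerSubgroup_le κ₁ κ₂ (le_trans (Nat.le_add_right n k) hnkm)) (isOpen_pairLayerSubgroup κ₁ κ₂ n)
        (isOpen_pairLayerSubgroup κ₁ κ₂ m) k 2 z := by
  have hnm : n ≤ m := le_trans (Nat.le_add_right n k) hnkm
  set w := (shO S (suppPF p 𝔣) θ (isOpen_pairLayerSubgroup κ₁ κ₂ m) k 2).symm z with hw
  have hzw : spLevel S κ₁ κ₂ θ 𝔣 m k 2 z = shO S (suppPF p 𝔣) θ (κ₁.isOpen_layerSubgroup m) k 2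
      (cohomologyMap (coindFinSum (coeffGSO S (suppPF p 𝔣) θ k).toTopRep
        (imGS_le_of_le (suppPF p 𝔣) (inf_le_left : pairLayerSubgroup κ₁ κ₂ m ≤ κ₁.layerSubgroup m))) 2 w) := by
    rw [shO_coindFinSum, hw, AddEquiv.apply_symm_apply]; rfl
  rw [hzw, AddEquiv.map_eq_zero_iff] at hz
  obtain ⟨v, hv⟩ := exists_rTransHom_sub_eq_of_map_two_eq_zero (coeffGSO S (suppPF p 𝔣) θ k)
    (imGS_le_of_le (suppPF p 𝔣) (inf_le_left : pairLayerSubgroup κ₁ κ₂ m ≤ κ₁.layerSubgroup m))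
    (imGS_le_of_le (suppPF p 𝔣) (pairLayerSubgroup_le κ₁ κ₂ hnm))
    (toUnramifiedQuot K (suppPF p 𝔣) γ₂)
    (isOpen_imGS_of_isOpen (suppPF p 𝔣) (κ₁.isOpen_layerSubgroup m)) (isOpen_imGS_of_isOpen (suppPF p 𝔣) (isOpen_pairLayerSubgroup κ₁ κ₂ m))
    (toUnramifiedQuot_mem_imGS (suppPF p 𝔣) (κ₁.kerSubgroup_le_layerSubgroup m hγ₁))
    (exists_eq_mul_pow_of_proj_eq (suppPF p 𝔣) κ₁ κ₂ hγ₁ hγu m)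
    (index_smul_eq_zero (suppPF p 𝔣) κ₁ κ₂ S θ hγ₁ hγu hnkm (hV m)) w hz
  refine ⟨shO S (suppPF p 𝔣) θ (isOpen_pairLayerSubgroup κ₁ κ₂ n) k 2 v, ?_⟩
  have h1 := shO_rTransHom_two S (suppPF p 𝔣) θ (isOpen_pairLayerSubgroup κ₁ κ₂ n) k γ₂ v
  have h2 := shO_coindFinSum S (suppPF p 𝔣) θ (pairLayerSubgroup_le κ₁ κ₂ hnm) (isOpen_pairLayerSubgroup κ₁ κ₂ n)
    (isOpen_pairLayerSubgroup κ₁ κ₂ m) k 2 w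
  rw [hw, AddEquiv.apply_symm_apply] at h2
  rw [← h2, ← hv, map_sub, layerConjO, ← h1]

end Level

/-! ## §3 On pinned data: `sp² x = 0 ⇒ D₂.proj n k x = conj_{γ₂} y − y` at every level -/

section Data

variable {K : Type} [Field K] [NumberField K] {p : ℕ} [Fact p.Prime] (S : Set (PadicAlgCl p))
  (κ₁ κ₂ : ZpExtension K p) {γ₁ γ₂ : absoluteGaloisGroup K} (θ : absoluteGaloisGroup K →ₜ* (padicCoeffIntegers S)ˣ) (𝔣 : Ideal (𝓞 K))

/-- **`proj_{n,k} = cor_{K̃_m/K̃_n} ∘ proj_{m,k}`** on any pinned two-variable datum, every degree `i` ((P1) iterated through the all-degree transitivity `relCoresO_relCoresO`).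
[cite: NeukirchSchmidtWingberg2008, I §5 Prop. 1.5.3 (iii)] [cite: JohnsonLeungKings2011, §4.2 Def. 4.2 (94) (arXiv p0012:L94)] -/
theorem relCoresO_pair_proj {i : ℕ} (D : IwasawaCohomologyDataO S κ₁ κ₂ γ₁ γ₂ θ 𝔣 i) (x : D.H) (k n : ℕ) : ∀ (m : ℕ) (h : n ≤ m),
    relCoresO S (suppPF p 𝔣) θ (pairLayerSubgroup_le κ₁ κ₂ h) (isOpen_pairLayerSubgroup κ₁ κ₂ n) (isOpen_pairLayerSubgroup κ₁ κ₂ m) k i (D.proj m k x) =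
      D.proj n k x := by
  have hstep : ∀ (m : ℕ) (h : n ≤ m), relCoresO S (suppPF p 𝔣) θ (pairLayerSubgroup_le κ₁ κ₂ h) (isOpen_pairLayerSubgroup κ₁ κ₂ n)
      (isOpen_pairLayerSubgroup κ₁ κ₂ m) k i (D.proj m k x) = relCoresO S (suppPF p 𝔣) θ (pairLayerSubgroup_le κ₁ κ₂ (h.trans (Nat.le_succ m)))
        (isOpen_pairLayerSubgroup κ₁ κ₂ n) (isOpen_pairLayerSubgroup κ₁ κ₂ (m + 1)) k i (D.proj (m + 1) k x) := fun m h ↦ by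
    rw [← D.proj_cores m k x, layerCoresO, relCoresO_relCoresO]
  refine Nat.le_induction ?_ (fun m hm ih ↦ ?_)
  · rw [hstep n le_rfl, ← D.proj_cores n k x, layerCoresO]
  · rw [← ih, hstep m hm]

variable [FiniteDimensional ℚ_[p] (padicCoeffField S)]
  (hγ₁ : γ₂ ∈ κ₁.kerSubgroup) (hγu : IsUnit (κ₂ γ₂).toAdd) (hV : ∀ m : ℕ, ramificationSubgroup K (suppPF p 𝔣) ≤ pairLayerSubgroup κ₁ κ₂ m)
  (D₂ : IwasawaCohomologyDataO S κ₁ κ₂ γ₁ γ₂ θ 𝔣 2) (D₁ : CycIwasawaCohomologyDataO S κ₁ γ₁ θ (suppPF p 𝔣) 2)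
  (res : D₂.H →+ D₁.H) (hres : ∀ (n k : ℕ) (x : D₂.H), D₁.proj n k (res x) = spLevel S κ₁ κ₂ θ 𝔣 n k 2 (D₂.proj n k x))

include hγ₁ hγu hV hres in
/-- ★★ **`sp² x = 0 ⇒` every projection of `x` is in the range of `conj_{γ₂} − 1`**: `∃ y, layerConjO n k 2 γ₂ y − y = D₂.proj n k x` (kernel transfer at `m = n + k`,
then `cor_{K̃_{n+k}/K̃_n} ∘ proj_{n+k,k} = proj_{n,k}`). The levelwise form of `ker sp² ⊆ T₂ • 𝐇²₂` (`proj n k (C X • y) = conj_{γ₂}(proj y) − proj y`, (P6)).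
[cite: PerrinRiou1994Invent, §1.3] [cite: JohnsonLeungKings2011, §4.2 Lemma 4.4] -/
theorem exists_layerConjO_sub_eq_proj_of_res_eq_zero (x : D₂.H) (hx : res x = 0) (n k : ℕ) :
    ∃ y : layerCohO S κ₁ κ₂ θ 𝔣 n k 2, layerConjO S κ₁ κ₂ θ 𝔣 n k 2 γ₂ y - y = D₂.proj n k x := by
  have h0 : spLevel S κ₁ κ₂ θ 𝔣 (n + k) k 2 (D₂.proj (n + k) k x) = 0 := by rw [← hres, hx, map_zero]
  obtain ⟨y, hy⟩ := exists_layerConjO_sub_eq_of_spLevel_eq_zero S κ₁ κ₂ θ 𝔣 hγ₁ hγu hV k le_rfl _ h0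
  exact ⟨y, hy.trans (relCoresO_pair_proj S κ₁ κ₂ θ 𝔣 D₂ x k n (n + k) (Nat.le_add_right n k))⟩

end Data

end Summit.BirchSwinnertonDyer.BirchSwinnertonDyer.Theorems.SmallImageRttJunctionSha

end
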